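import Literature.AlgebraicGeometry.Limits.SmoothProjectiveFamilyModelAdjoin
import HarnessLib

/-!
# Base change of a Proj-embedded smooth proper family, with the comparison maps

Topic `Literature/AlgebraicGeometry/Limits` (EGA IV₃ §8; Maulik–Poonen 2012, §4). Complement to
`SmoothProjectiveFamilyModelAdjoin`: the base change `m ⊗_R R'` of a Proj-embedded smooth proper model
`m = (Spec B → Spec R, π, Y ↪ ℙᴹ_B, g, π𝒳)` of a family along `R → R' → K` together with its
COMPARISON MAPS to `m` (`B → B'`, `ρ : Y' → Y`, cartesian squares, compatibility with the embeddings
and the base points). This is the shape in which an argument first fixes a model, then asks for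
finitely many more scalars in the model ring (e.g. the coefficients of a cycle on one fibre, whose
field of definition depends on the model), and transports structures from `m` to the enlarged model.

Everything is proved; no definitions, no named facts.

## References

* [EGAIV3] A. Grothendieck, J. Dieudonné, EGA IV₃, Thm. 8.8.2 (ii).
* [MaulikPoonen2012] D. Maulik, B. Poonen, Néron–Severi groups under specialization, Duke Math.
  J. 161 (2012), §4.
-/

noncomputable section

universe u

open CategoryTheory CategoryTheory.Limits AlgebraicGeometry TopologicalSpace MonoidalCategory
open MvPolynomial
open scoped TensorProduct

namespace Literature.AlgebraicGeometry.Limits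

open Literature.AlgebraicGeometry.Motives
open Literature.AlgebraicGeometry.Motives.ProjBaseChangeRing (projToSpec)

set_option backward.isDefEq.respectTransparency false

/-- **Base change of a Proj-embedded smooth proper family, WITH the comparison maps** (the form of
`smooth_projective_family_model_baseChange` needed when a later argument — e.g. a cycle on one fibre
whose field of definition depends on the model — asks for an enlargement of the model ring AFTER the
model is fixed): given the model data over `R → K` and an intermediate ring `R → R' → K`, the
base-changed data over `R'` come with a `B`-algebra structure on `B'`, the cartesian square
`Spec B' → Spec B` over `Spec R' → Spec R`, the projection `ρ : Y' → Y` cartesian over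
`Spec B' → Spec B` and compatible with the embeddings (`emb' ≫ ℙᴹ(B → B') = ρ ≫ emb`), and the
compatibilities `π' ≫ (Spec B' → Spec B) = π`, `π𝒳' ≫ ρ = π𝒳`. [cite: EGAIV3, Thm. 8.8.2 (ii)] -/
theorem smooth_projective_family_model_baseChange_comparison {K : Type u} [Field K] {d n M : ℕ}
    (S : SchemeOver K) {𝒳 : SchemeOver K} (f : 𝒳 ⟶ S)
    {R : Type u} [CommRing R] [Algebra R K] {R' : Type u} [CommRing R'] [Algebra R R']
    [Algebra R' K] [IsScalarTower R R' K]
    {B : Type u} [CommRing B] [Algebra R B] [Algebra.FiniteType R B]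
    (π : S.left ⟶ Spec (.of B)) {Y : Scheme.{u}} (g : Y ⟶ Spec (.of B))
    (emb : letI := MvPolynomial.gradedAlgebra (σ := Fin (M + 1)) (R := B)
      Y ⟶ Proj (homogeneousSubmodule (Fin (M + 1)) B)) [IsClosedImmersion emb]
    (hembg : letI := MvPolynomial.gradedAlgebra (σ := Fin (M + 1)) (R := B)
      emb ≫ projToSpec (Fin (M + 1)) B = g)
    (π𝒳 : 𝒳.left ⟶ Y)
    (hBd : SmoothOfRelativeDimension d (Spec.map (CommRingCat.ofHom (algebraMap R B))))
    (Hπ : IsPullback π S.hom (Spec.map (CommRingCat.ofHom (algebraMap R B)))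
      (Spec.map (CommRingCat.ofHom (algebraMap R K))))
    [IsProper g] (hgn : SmoothOfRelativeDimension n g) (H𝒳 : IsPullback π𝒳 f.left g π) :
    ∃ (B' : Type u) (_ : CommRing B') (_ : Algebra R' B') (_ : Algebra B B')
      (_ : Algebra.FiniteType R' B')
      (π' : S.left ⟶ Spec (.of B')) (Y' : Scheme.{u}) (g' : Y' ⟶ Spec (.of B'))
      (emb' : letI := MvPolynomial.gradedAlgebra (σ := Fin (M + 1)) (R := B')
        Y' ⟶ Proj (homogeneousSubmodule (Fin (M + 1)) B')) (_ : IsClosedImmersion emb')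
      (_ : letI := MvPolynomial.gradedAlgebra (σ := Fin (M + 1)) (R := B')
        emb' ≫ projToSpec (Fin (M + 1)) B' = g')
      (π𝒳' : 𝒳.left ⟶ Y') (ρ : Y' ⟶ Y),
      SmoothOfRelativeDimension d (Spec.map (CommRingCat.ofHom (algebraMap R' B'))) ∧
      IsPullback π' S.hom (Spec.map (CommRingCat.ofHom (algebraMap R' B')))
        (Spec.map (CommRingCat.ofHom (algebraMap R' K))) ∧
      IsProper g' ∧ SmoothOfRelativeDimension n g' ∧ IsPullback π𝒳' f.left g' π' ∧
      IsPullback (Spec.map (CommRingCat.ofHom (algebraMap B B')))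
        (Spec.map (CommRingCat.ofHom (algebraMap R' B')))
        (Spec.map (CommRingCat.ofHom (algebraMap R B)))
        (Spec.map (CommRingCat.ofHom (algebraMap R R'))) ∧
      IsPullback ρ g' g (Spec.map (CommRingCat.ofHom (algebraMap B B'))) ∧
      (letI := MvPolynomial.gradedAlgebra (σ := Fin (M + 1)) (R := B)
      letI := MvPolynomial.gradedAlgebra (σ := Fin (M + 1)) (R := B')
      emb' ≫ Proj.map _ (ProjBaseChangeRing.irrelevant_le_map B B' (Fin (M + 1))) = ρ ≫ emb) ∧
      π' ≫ Spec.map (CommRingCat.ofHom (algebraMap B B')) = π ∧ π𝒳' ≫ ρ = π𝒳 := by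
  classical
  letI := MvPolynomial.gradedAlgebra (σ := Fin (M + 1)) (R := B)
  -- 1. the ring `B' = R' ⊗_R B` (kept opaque) with its two structure maps and its pushout square
  obtain ⟨B', _, _, _, hB'ft, sqB⟩ : ∃ (B' : Type u) (_ : CommRing B') (_ : Algebra R' B')
      (_ : Algebra B B'), Algebra.FiniteType R' B' ∧
      IsPullback (Spec.map (CommRingCat.ofHom (algebraMap B B')))
        (Spec.map (CommRingCat.ofHom (algebraMap R' B')))
        (Spec.map (CommRingCat.ofHom (algebraMap R B)))
        (Spec.map (CommRingCat.ofHom (algebraMap R R'))) := by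
    letI : Algebra B (R' ⊗[R] B) := Algebra.TensorProduct.rightAlgebra
    exact ⟨R' ⊗[R] B, inferInstance, inferInstance, inferInstance, inferInstance,
      isPullback_specMap_includeRight (K := R') (R := R) B⟩
  letI := MvPolynomial.gradedAlgebra (σ := Fin (M + 1)) (R := B')
  have hRK : Spec.map (CommRingCat.ofHom (algebraMap R K)) =
      Spec.map (CommRingCat.ofHom (algebraMap R' K)) ≫
        Spec.map (CommRingCat.ofHom (algebraMap R R')) := by
    rw [← Spec.map_comp, ← CommRingCat.ofHom_comp, ← IsScalarTower.algebraMap_eq]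
  -- 2. the base point `π' : S → Spec B'`
  have hwπ : π ≫ Spec.map (CommRingCat.ofHom (algebraMap R B)) =
      (S.hom ≫ Spec.map (CommRingCat.ofHom (algebraMap R' K))) ≫
        Spec.map (CommRingCat.ofHom (algebraMap R R')) := by
    rw [Category.assoc, ← hRK]; exact Hπ.w
  let π' : S.left ⟶ Spec (.of B') :=
    sqB.lift π (S.hom ≫ Spec.map (CommRingCat.ofHom (algebraMap R' K))) hwπ
  have hπ'_fst : π' ≫ Spec.map (CommRingCat.ofHom (algebraMap B B')) = π := sqB.lift_fst _ _ hwπ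
  have hπ'_snd : π' ≫ Spec.map (CommRingCat.ofHom (algebraMap R' B')) =
      S.hom ≫ Spec.map (CommRingCat.ofHom (algebraMap R' K)) := sqB.lift_snd _ _ hwπ
  have Hπ' : IsPullback π' S.hom (Spec.map (CommRingCat.ofHom (algebraMap R' B')))
      (Spec.map (CommRingCat.ofHom (algebraMap R' K))) := by
    refine IsPullback.of_right ?_ hπ'_snd sqB
    rw [hπ'_fst, ← hRK]
    exact Hπ
  -- 3. the family `Y' = Y ×_B Spec B'` and its embedding into `ℙᴹ_{B'}`
  obtain ⟨prB, hprB⟩ : ∃ prB : Proj (homogeneousSubmodule (Fin (M + 1)) B) ⟶ Spec (.of B),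
      prB = projToSpec (Fin (M + 1)) B := ⟨_, rfl⟩
  obtain ⟨prB', hprB'⟩ : ∃ prB' : Proj (homogeneousSubmodule (Fin (M + 1)) B') ⟶ Spec (.of B'),
      prB' = projToSpec (Fin (M + 1)) B' := ⟨_, rfl⟩
  have sqP : IsPullback (Proj.map _ (ProjBaseChangeRing.irrelevant_le_map B B' (Fin (M + 1)))) prB'
      prB (Spec.map (CommRingCat.ofHom (algebraMap B B'))) := by
    rw [hprB, hprB']; exact ProjBaseChangeRing.isPullback_projMap' (k := B) (L := B') (n := M)
  have hembg' : emb ≫ prB = g := by rw [hprB]; exact hembg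
  have sqY := IsPullback.of_hasPullback g (Spec.map (CommRingCat.ofHom (algebraMap B B')))
  let Y' : Scheme.{u} := pullback g (Spec.map (CommRingCat.ofHom (algebraMap B B')))
  let g' : Y' ⟶ Spec (.of B') := pullback.snd g (Spec.map (CommRingCat.ofHom (algebraMap B B')))
  have hw' : (pullback.fst g (Spec.map (CommRingCat.ofHom (algebraMap B B'))) ≫ emb) ≫ prB =
      g' ≫ Spec.map (CommRingCat.ofHom (algebraMap B B')) := by
    rw [Category.assoc, hembg']; exact pullback.condition
  let emb' : Y' ⟶ Proj (homogeneousSubmodule (Fin (M + 1)) B') := sqP.lift _ _ hw'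
  have hemb'_fst : emb' ≫ Proj.map _ (ProjBaseChangeRing.irrelevant_le_map B B' (Fin (M + 1))) =
      pullback.fst g (Spec.map (CommRingCat.ofHom (algebraMap B B'))) ≫ emb := sqP.lift_fst _ _ hw'
  have hemb'_snd : emb' ≫ prB' = g' := sqP.lift_snd _ _ hw'
  haveI : IsClosedImmersion emb' := by
    have s : IsPullback (pullback.fst g (Spec.map (CommRingCat.ofHom (algebraMap B B'))))
        (emb' ≫ prB') (emb ≫ prB) (Spec.map (CommRingCat.ofHom (algebraMap B B'))) := by
      rw [hemb'_snd, hembg']; exact sqY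
    have top : IsPullback (pullback.fst g (Spec.map (CommRingCat.ofHom (algebraMap B B')))) emb' emb
        (Proj.map _ (ProjBaseChangeRing.irrelevant_le_map B B' (Fin (M + 1)))) :=
      IsPullback.of_bot s hemb'_fst.symm sqP
    exact MorphismProperty.of_isPullback top inferInstance
  -- 4. properness, smoothness
  haveI : IsProper g' := inferInstance
  haveI := smoothOfRelativeDimension_isStableUnderBaseChange (n := n)
  have hgn' : SmoothOfRelativeDimension n g' := MorphismProperty.of_isPullback sqY hgn
  haveI := smoothOfRelativeDimension_isStableUnderBaseChange (n := d)
  have hBd' : SmoothOfRelativeDimension d (Spec.map (CommRingCat.ofHom (algebraMap R' B'))) :=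
    MorphismProperty.of_isPullback sqB hBd
  -- 5. the cartesian square for `𝒳`
  have hw𝒳 : π𝒳 ≫ g = (f.left ≫ π') ≫ Spec.map (CommRingCat.ofHom (algebraMap B B')) := by
    rw [Category.assoc, hπ'_fst]; exact H𝒳.w
  let π𝒳' : 𝒳.left ⟶ Y' := pullback.lift π𝒳 (f.left ≫ π') hw𝒳
  have hπ𝒳'_fst : π𝒳' ≫ pullback.fst g (Spec.map (CommRingCat.ofHom (algebraMap B B'))) = π𝒳 :=
    pullback.lift_fst _ _ hw𝒳
  have hπ𝒳'_snd : π𝒳' ≫ g' = f.left ≫ π' := pullback.lift_snd _ _ hw𝒳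
  have H𝒳' : IsPullback π𝒳' f.left g' π' := by
    refine IsPullback.of_right ?_ hπ𝒳'_snd sqY
    rw [hπ𝒳'_fst, hπ'_fst]
    exact H𝒳
  exact ⟨B', inferInstance, inferInstance, inferInstance, hB'ft, π', Y', g', emb', inferInstance,
    by rw [← hprB']; exact hemb'_snd, π𝒳', pullback.fst g (Spec.map (CommRingCat.ofHom (algebraMap B B'))),
    hBd', Hπ', inferInstance, hgn', H𝒳', sqB, sqY, hemb'_fst, hπ'_fst, hπ𝒳'_fst⟩


end Literature.AlgebraicGeometry.Limits

end
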